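import Literature.AnabelianGeometry.AbsoluteAnabelian.AbsTopII.TwoTripodNodalIndexInertia
import HarnessLib

/-!
# [AbsTopII] Prop 1.3 (ii′) at the index-`i` two-vertex datum: the branch pair `I_{v_A} × I_{v_B} ↪ I_e` has image of index EXACTLY `i`

S. Mochizuki, *Topics in Absolute Anabelian Geometry II* [AbsTopII] (bib `MochizukiAbsTopII2013`; locators =
PDF pages of the kurims manuscript `paper:url-585b8d0ad0d9`), §1 Prop 1.3 (ii) p. 11:

> "if `e` abuts to vertices `v, v′`, then [for appropriate choices of conjugates] we have inclusions
> `I_v, I_{v′} ⊆ I_e`, and the natural morphism `I_v × I_{v′} → I_e` is an open injective homomorphism, with image of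
> index equal to `i^Σ_e`."

PROOF-ONLY companion (abc-iut-f-066 gen 8, row «TWO-VERTEX-Σ-INDEX-i») of `AbsTopII/TwoTripodNodalIndexDatum.lean`,
over `TwoTripodNodalIndexInertia.lean` (`I_{v_A} = closure ⟨t₀^i⟩`, `I_{v_B} = closure ⟨u₀^i⟩`,
`I_e = Π_e · closure ⟨t₀^i⟩`).  At the regular smoothing `M.dpsc` (`i^Σ_e = 1`) the index clause was decided only
IDLY (`relIndex_self`, abc-iut-f-066 gen 5); here, at node index `i`, it is decided NON-IDLY at two DISTINCT
end-vertices (the loop datum of abc-iut-L4-t6 has the two BRANCH conjugates of one vertex instead):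

* `Tpow_sup_Upow_eq` — **`J := I_{v_A} · I_{v_B} = closure ⟨w^i⟩ · closure ⟨t₀^i⟩`** (`u₀^i = w^{-i} t₀^i`), an internal
  product `I_{v_A} × I_{v_B}` (`T ∩ U = 1`, abc-iut-f-066 gen 5);
* `exists_projW` — the continuous projection `ψ : I_e = Π_e × closure ⟨t₀^i⟩ ↠ Π_e`, `a k ↦ a` (`x ↦ x · F(x)⁻¹` for
  the retraction `F : P ↠ T`, abc-iut-f-066 gen 5), under which `J = ψ⁻¹(closure ⟨w^i⟩)`;
* ★ `exists_branchPair_dpscIdx` — `J ⊆ I_e` is OPEN of index `[Π_e : closure ⟨w^i⟩] = i` (`Π_e ≅ Ẑ^Σ`,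
  `isOpen_closureZpowersPow`, `index_comap_of_surjective`);
* ★★ `prop_1_3_ii'_dpscIdx` — **the typed `Prop_1_3_ii'` (abc-iut-w5-d102 v2, branch reading) HOLDS at the index-`i`
  two-vertex datum, ALL THREE CLAUSES, the index clause `[I_e : I_{v_A}·I_{v_B}] = i^Σ_e = i` attained NON-IDLY, every
  `Σ`, every `Σ`-integer `i`, NO hypothesis**; `exists_twoVertex_nodal_model_ii'_index` the census form.
HONEST FRAMING: classical profinite group theory at a constructed model (constructed ≠ geometric); consistency
evidence for the typed (ii′) row, not a discharge at geometric data; nothing here bears on [IUTchIII] Cor 3.12; no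
side taken; typed ≠ proved for print's statement about all stable log curves.
-/

noncomputable section

open scoped Pointwise

namespace Literature.AnabelianGeometry.AbsoluteAnabelian.AbsTopII.TwoTripodNodal.Model

open Literature.AnabelianGeometry.SemiGraphs
open Literature.AnabelianGeometry.SemiGraphs.SemiGraphOfAnabelioids (IsProSigmaCompletion)
open Literature.AnabelianGeometry.SemiGraphs.SemiGraphOfAnabelioids.IsProSigmaCompletion
open Literature.AnabelianGeometry.Anabelioids (IsSigmaInteger)
open Literature.GroupTheory.CombinatorialGroupTheory
open Literature.GroupTheory.CombinatorialGroupTheory.PuncturedSurfaceGroup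
open _root_.Topology

variable {Sigma : Set ℕ} (M : Model Sigma) (i : ℕ)

/-! ### `J = I_{v_A} · I_{v_B} = closure ⟨w^i⟩ · closure ⟨t₀^i⟩` -/

/-- `closure ⟨t₀^i⟩` and `closure ⟨u₀^i⟩` commute elementwise (`T`, `U` do). [cite: MochizukiAbsTopII2013, Prop 1.3 (ii) p.11] -/
theorem Tpow_commute_Upow : ∀ k ∈ M.Tpow i, ∀ u ∈ M.Upow i, k * u = u * k :=
  fun k hk u hu => M.T_commute_U k (M.Tpow_le_T i hk) u (M.Upow_le_U i hu)

/-- `closure ⟨t₀^i⟩ ∩ closure ⟨u₀^i⟩ = 1` (`T ∩ U = 1`). [cite: MochizukiAbsTopII2013, Prop 1.3 (iv) p.11] -/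
theorem Tpow_inf_Upow : M.Tpow i ⊓ M.Upow i = ⊥ := by
  rw [eq_bot_iff, ← M.T_inf_U]; exact inf_le_inf (M.Tpow_le_T i) (M.Upow_le_U i)

/-- `closure ⟨t₀^i⟩ · closure ⟨u₀^i⟩` has carrier the product set and is closed. [cite: MochizukiAbsTopII2013, Prop 1.3 (ii) p.11] -/
theorem coe_Tpow_sup_Upow : ((M.Tpow i ⊔ M.Upow i : Subgroup M.P) : Set M.P) = (M.Tpow i : Set M.P) * (M.Upow i : Set M.P) ∧
    IsClosed ((M.Tpow i ⊔ M.Upow i : Subgroup M.P) : Set M.P) :=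
  M.isClosed_sup_of_commute (Subgroup.isClosed_topologicalClosure _) (Subgroup.isClosed_topologicalClosure _)
    (M.Tpow_commute_Upow i)

/-- `closure ⟨w^i⟩` and `closure ⟨t₀^i⟩` commute elementwise. [cite: MochizukiAbsTopII2013, Prop 1.3 (ii) p.11] -/
theorem Wpow_commute_Tpow : ∀ a ∈ M.Wpow i, ∀ k ∈ M.Tpow i, a * k = k * a :=
  fun a ha k hk => M.W_commute_Tpow i a (M.Wpow_le_W i ha) k hk

/-- `closure ⟨w^i⟩ · closure ⟨t₀^i⟩` has carrier the product set and is closed. [cite: MochizukiAbsTopII2013, Prop 1.3 (ii) p.11] -/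
theorem coe_Wpow_sup_Tpow : ((M.Wpow i ⊔ M.Tpow i : Subgroup M.P) : Set M.P) = (M.Wpow i : Set M.P) * (M.Tpow i : Set M.P) ∧
    IsClosed ((M.Wpow i ⊔ M.Tpow i : Subgroup M.P) : Set M.P) :=
  M.isClosed_sup_of_commute (Subgroup.isClosed_topologicalClosure _) (Subgroup.isClosed_topologicalClosure _)
    (M.Wpow_commute_Tpow i)

/-- **`I_{v_A} · I_{v_B} = closure ⟨w^i⟩ · closure ⟨t₀^i⟩`** (`u₀^i = w^{-i} t₀^i`, `w^i = t₀^i u₀^{-i}`; both products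
are closed). [cite: MochizukiAbsTopII2013, Prop 1.3 (ii) p.11] -/
theorem Tpow_sup_Upow_eq : M.Tpow i ⊔ M.Upow i = M.Wpow i ⊔ M.Tpow i := by
  apply le_antisymm
  · refine sup_le le_sup_right (Subgroup.topologicalClosure_minimal _ ((Subgroup.zpowers_le).mpr ?_)
      (M.coe_Wpow_sup_Tpow i).2)
    rw [u0_pow_eq]
    exact Subgroup.mul_mem _ (Subgroup.mem_sup_left (Subgroup.inv_mem _ (M.w_pow_mem_Wpow i)))
      (Subgroup.mem_sup_right (M.t0_pow_mem_Tpow i))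
  · refine sup_le (Subgroup.topologicalClosure_minimal _ ((Subgroup.zpowers_le).mpr ?_) (M.coe_Tpow_sup_Upow i).2)
      le_sup_left
    have h : (M.ι (SemidirectProduct.inl (c 1 * c 2 : PuncturedSurfaceGroup 0 4))) ^ i =
        M.ι (SemidirectProduct.inr (Multiplicative.ofAdd (1 : ℤ))) ^ i *
          (M.ι (SemidirectProduct.inl (c 1 * c 2 : PuncturedSurfaceGroup 0 4)⁻¹ *
            SemidirectProduct.inr (Multiplicative.ofAdd (1 : ℤ))) ^ i)⁻¹ := by
      rw [t0_pow_eq, mul_inv_cancel_right]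
    rw [h]
    exact Subgroup.mul_mem _ (Subgroup.mem_sup_left (M.t0_pow_mem_Tpow i))
      (Subgroup.inv_mem _ (Subgroup.mem_sup_right (M.u0_pow_mem_Upow i)))

/-- `I_{v_A} · I_{v_B} ⊆ I_e = Π_e · closure ⟨t₀^i⟩`. [cite: MochizukiAbsTopII2013, Prop 1.3 (ii) p.11] -/
theorem Tpow_sup_Upow_le : M.Tpow i ⊔ M.Upow i ≤ (M.nodeGp).map M.PiG.subtype ⊔ M.Tpow i := by
  rw [Tpow_sup_Upow_eq]; exact sup_le_sup_right (M.Wpow_le_W i) _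

/-- **`I_{v_A} × I_{v_B} ⥲ J`** as an internal product. [cite: MochizukiAbsTopII2013, Prop 1.3 (ii) p.11] -/
theorem isInternalProduct_Tpow_Upow : IsInternalProduct (M.Tpow i) (M.Upow i) (M.Tpow i ⊔ M.Upow i) :=
  ⟨le_sup_left, le_sup_right, M.Tpow_commute_Upow i, M.Tpow_inf_Upow i, rfl⟩

/-- The same internal product read from `v_B`: `I_{v_B} × I_{v_A} ⥲ J`. [cite: MochizukiAbsTopII2013, Prop 1.3 (ii) p.11] -/
theorem isInternalProduct_Upow_Tpow : IsInternalProduct (M.Upow i) (M.Tpow i) (M.Tpow i ⊔ M.Upow i) :=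
  ⟨le_sup_right, le_sup_left, fun u hu k hk => (M.Tpow_commute_Upow i k hk u hu).symm,
    by rw [inf_comm]; exact M.Tpow_inf_Upow i, sup_comm _ _⟩

/-! ### The projection `ψ : Π_e · closure ⟨t₀^i⟩ ↠ Π_e` -/

/-- **The projection onto the nodal factor.**  There is a continuous homomorphism `ψ : Π_e · closure ⟨t₀^i⟩ → Π_e` with
`ψ(a k) = a` (`a ∈ Π_e`, `k ∈ closure ⟨t₀^i⟩`): `x ↦ x · F(x)⁻¹` for the continuous retraction `F : P ↠ T` (identity on
`T`, trivial on `Π_𝔾 ⊇ Π_e`). [cite: MochizukiAbsTopII2013, Prop 1.3 (ii) p.11] -/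
theorem exists_projW : ∃ ψ : ↥((M.nodeGp).map M.PiG.subtype ⊔ M.Tpow i) →* ↥((M.nodeGp).map M.PiG.subtype),
    Continuous ψ ∧
      ∀ (x : ↥((M.nodeGp).map M.PiG.subtype ⊔ M.Tpow i)) (a : M.P), a ∈ (M.nodeGp).map M.PiG.subtype →
        ∀ k ∈ M.Tpow i, (x : M.P) = a * k → (ψ x : M.P) = a := by
  obtain ⟨F, hFc, -, hFT, hFA⟩ : ∃ F : M.P →* ↥M.T, Continuous F ∧
      (∀ x, (F (M.ι x) : M.P) = M.ι (SemidirectProduct.inr (SemidirectProduct.rightHom x))) ∧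
      (∀ (t : M.P) (_ : t ∈ M.T), (F t : M.P) = t) ∧ ∀ a ∈ M.PiG, F a = 1 :=
    SemidirectCofinal.exists_retraction M.φ M.isProSigmaCompletion
  -- `F(a k) = k`
  have hFval : ∀ (a : M.P), a ∈ (M.nodeGp).map M.PiG.subtype → ∀ k ∈ M.Tpow i, (F (a * k) : M.P) = k := by
    intro a ha k hk
    rw [map_mul, hFA a (Subgroup.map_subtype_le _ ha), one_mul, hFT k (M.Tpow_le_T i hk)]
  have hmem : ∀ x : ↥((M.nodeGp).map M.PiG.subtype ⊔ M.Tpow i),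
      (x : M.P) * ((F x : ↥M.T) : M.P)⁻¹ ∈ (M.nodeGp).map M.PiG.subtype := by
    intro x
    obtain ⟨a, ha, k, hk, hx⟩ := M.exists_mul_of_mem_sup
      (fun k hk => Subgroup.mem_centralizer_iff.mpr fun a ha => M.W_commute_Tpow i a ha k hk) x.2
    rw [hx, hFval a ha k hk, mul_inv_cancel_right]; exact ha
  let ψ : ↥((M.nodeGp).map M.PiG.subtype ⊔ M.Tpow i) →* ↥((M.nodeGp).map M.PiG.subtype) :=
    { toFun := fun x => ⟨(x : M.P) * ((F x : ↥M.T) : M.P)⁻¹, hmem x⟩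
      map_one' := Subtype.ext (by simp)
      map_mul' := fun x y => Subtype.ext (by
        show ((x : M.P) * y) * ((F ((x : M.P) * y) : ↥M.T) : M.P)⁻¹ =
          (x : M.P) * ((F x : ↥M.T) : M.P)⁻¹ * ((y : M.P) * ((F y : ↥M.T) : M.P)⁻¹)
        have hc : ((F x : ↥M.T) : M.P)⁻¹ * ((y : M.P) * ((F y : ↥M.T) : M.P)⁻¹) =
            ((y : M.P) * ((F y : ↥M.T) : M.P)⁻¹) * ((F x : ↥M.T) : M.P)⁻¹ :=
          (M.W_commute_T _ (hmem y) _ (M.T.inv_mem (F x).2)).symm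
        rw [map_mul, Subgroup.coe_mul, mul_inv_rev, mul_assoc (x : M.P) (((F x : ↥M.T) : M.P))⁻¹, hc]
        simp only [mul_assoc]) }
  refine ⟨ψ, ?_, fun x a ha k hk hx => ?_⟩
  · exact (continuous_subtype_val.mul (continuous_subtype_val.comp (hFc.comp continuous_subtype_val)).inv).subtype_mk _
  · show (x : M.P) * ((F x : ↥M.T) : M.P)⁻¹ = a
    rw [hx, hFval a ha k hk, mul_inv_cancel_right]

/-! ### The branch clause: `J ⊆ I_e` open of index `i` -/

/-- ★ **The branch pair at node index `i`**: `J := I_{v_A} · I_{v_B}` is an internal product `I_{v_A} × I_{v_B}`, lies in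
`I_e = Π_e · closure ⟨t₀^i⟩`, is OPEN there, and has index `[I_e : J] = [Π_e : closure ⟨w^i⟩] = i` (`Π_e ≅ Ẑ^Σ`, `i` a
`Σ`-integer). [cite: MochizukiAbsTopII2013, Prop 1.3 (ii) p.11] -/
theorem exists_branchPair_dpscIdx (hi : IsSigmaInteger Sigma i) :
    IsInternalProduct (M.Tpow i) (M.Upow i) (M.Tpow i ⊔ M.Upow i) ∧
      M.Tpow i ⊔ M.Upow i ≤ (M.nodeGp).map M.PiG.subtype ⊔ M.Tpow i ∧
      IsOpen (((M.Tpow i ⊔ M.Upow i).subgroupOf ((M.nodeGp).map M.PiG.subtype ⊔ M.Tpow i) :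
        Subgroup ↥((M.nodeGp).map M.PiG.subtype ⊔ M.Tpow i)) : Set ↥((M.nodeGp).map M.PiG.subtype ⊔ M.Tpow i)) ∧
      (M.Tpow i ⊔ M.Upow i).relIndex ((M.nodeGp).map M.PiG.subtype ⊔ M.Tpow i) = i := by
  obtain ⟨ψ, hψc, hψ⟩ := M.exists_projW i
  -- `J ∩ I_e`, read in `I_e`, is `ψ⁻¹(closure ⟨w^i⟩)`
  have hJ : (M.Tpow i ⊔ M.Upow i).subgroupOf ((M.nodeGp).map M.PiG.subtype ⊔ M.Tpow i) = (M.WpowW i).comap ψ := by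
    ext x
    rw [Subgroup.mem_subgroupOf, Subgroup.mem_comap, ← Wpow_subgroupOf_W, Subgroup.mem_subgroupOf, Tpow_sup_Upow_eq]
    obtain ⟨a, ha, k, hk, hx⟩ := M.exists_mul_of_mem_sup
      (fun k hk => Subgroup.mem_centralizer_iff.mpr fun a ha => M.W_commute_Tpow i a ha k hk) x.2
    rw [hψ x a ha k hk hx]
    constructor
    · intro h
      have h' : (x : M.P) ∈ ((M.Wpow i ⊔ M.Tpow i : Subgroup M.P) : Set M.P) := h
      rw [(M.coe_Wpow_sup_Tpow i).1] at h'
      obtain ⟨a', ha', k', hk', hx'⟩ := Set.mem_mul.mp h'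
      have : a = a' := by rw [← hψ x a ha k hk hx, ← hψ x a' (M.Wpow_le_W i ha') k' hk' hx'.symm]
      rw [this]; exact ha'
    · intro h
      rw [hx]; exact Subgroup.mul_mem _ (Subgroup.mem_sup_left h) (Subgroup.mem_sup_right hk)
  -- `ψ` is surjective (`ψ(a) = a`)
  have hψs : Function.Surjective ψ := fun a =>
    ⟨⟨a, Subgroup.mem_sup_left a.2⟩, Subtype.ext (by rw [hψ _ a a.2 1 (Subgroup.one_mem _) (by rw [mul_one])])⟩
  refine ⟨M.isInternalProduct_Tpow_Upow i, M.Tpow_sup_Upow_le i, ?_, ?_⟩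
  · rw [hJ]; exact (M.isOpen_WpowW i hi).1.preimage hψc
  · rw [Subgroup.relIndex, hJ, Subgroup.index_comap_of_surjective _ hψs]
    exact (M.isOpen_WpowW i hi).2

section Dpsc

variable (hne : Sigma.Nonempty) (hprime : ∀ p ∈ Sigma, p.Prime) (hi : IsSigmaInteger Sigma i)

/-- ★★ **[AbsTopII] Prop 1.3 (ii) with the printed branch pair (`Prop_1_3_ii'`, v2) HOLDS at the index-`i` two-vertex
datum `M.dpscIdx`, ALL THREE CLAUSES, NO hypothesis**: `1 → Π_e → I_e → I → 1` exact, `I_e = Π_e × closure ⟨t₀^i⟩ ≅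
Ẑ^Σ × Ẑ^Σ`, and for the branch pair `(v_A, v_B)` (conjugating elements `1 ∈ Π_𝔾`) `I_{v_A} × I_{v_B} ⥲ J ⊆ I_e` open
with `[I_e : J] = i = i^Σ_e` — the index clause NON-IDLE at two DISTINCT end-vertices; the diagonal pairs `(v, v)` are
excluded by the guard (the node is not a loop). [cite: MochizukiAbsTopII2013, Prop 1.3 (ii) p.11] -/
theorem prop_1_3_ii'_dpscIdx :
    Literature.AnabelianGeometry.AbsoluteAnabelian.AbsTopII.DPSCIndexData.Prop_1_3_ii' (M.dpscIdx hne hprime i hi) := by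
  intro e
  refine ⟨M.prop_1_3_ii'_exact_dpscIdx i hne hprime hi e, M.prop_1_3_ii'_product_dpscIdx i hne hprime hi e, ?_⟩
  intro v v' _ _ hguard
  obtain ⟨hprod, hle, hopen, hidx⟩ := M.exists_branchPair_dpscIdx i hi
  rcases M.vert_cases_dpscIdx i hne hprime hi v with rfl | rfl <;>
    rcases M.vert_cases_dpscIdx i hne hprime hi v' with rfl | rfl
  · exfalso
    rcases hguard with h | h
    · exact h rfl
    · exact M.vert_zero_ne_one hne hprime (h ⟨(1 : Fin 2)⟩ (M.nodeAbuts_dpscIdx i hne hprime hi e _)).symm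
  · refine ⟨1, 1, Subgroup.one_mem _, Subgroup.one_mem _, M.Tpow i ⊔ M.Upow i, ?_, ?_, ?_, ?_⟩
    · rw [map_one, one_smul, one_smul, Iv_zero_dpscIdx, Iv_one_dpscIdx]; exact hprod
    · rw [IvNode_dpscIdx_eq]; exact hle
    · rw [IvNode_dpscIdx_eq]; exact hopen
    · rw [IvNode_dpscIdx_eq, dpscIdx_sigmaIndex]; exact hidx
  · refine ⟨1, 1, Subgroup.one_mem _, Subgroup.one_mem _, M.Tpow i ⊔ M.Upow i, ?_, ?_, ?_, ?_⟩
    · rw [map_one, one_smul, one_smul, Iv_zero_dpscIdx, Iv_one_dpscIdx]; exact M.isInternalProduct_Upow_Tpow i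
    · rw [IvNode_dpscIdx_eq]; exact hle
    · rw [IvNode_dpscIdx_eq]; exact hopen
    · rw [IvNode_dpscIdx_eq, dpscIdx_sigmaIndex]; exact hidx
  · exfalso
    rcases hguard with h | h
    · exact h rfl
    · exact M.vert_zero_ne_one hne hprime (h ⟨(0 : Fin 2)⟩ (M.nodeAbuts_dpscIdx i hne hprime hi e _))

/-- The branch-pair situation is INHABITED NON-IDLY at the index-`i` datum: there are a node `e` and end-vertices
`v ≠ v'` of `e` passing the guard, with `I_v · I_{v'}` of index EXACTLY `i` in `I_e` (so for `i ≥ 2` the image is a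
PROPER open subgroup). [cite: MochizukiAbsTopII2013, Prop 1.3 (ii) p.11] -/
theorem branchPair_nonidle_dpscIdx :
    ∃ (e : (M.dpscIdx hne hprime i hi).Node) (v v' : (M.dpscIdx hne hprime i hi).Vert),
      (M.dpscIdx hne hprime i hi).nodeAbuts e v ∧ (M.dpscIdx hne hprime i hi).nodeAbuts e v' ∧ v ≠ v' ∧
      ((M.dpscIdx hne hprime i hi).Iv v ⊔ (M.dpscIdx hne hprime i hi).Iv v').relIndex
        ((M.dpscIdx hne hprime i hi).IvNode e) = (M.dpscIdx hne hprime i hi).sigmaIndex e ∧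
      (M.dpscIdx hne hprime i hi).sigmaIndex e = i := by
  refine ⟨⟨()⟩, ⟨(0 : Fin 2)⟩, ⟨(1 : Fin 2)⟩, M.nodeAbuts_dpscIdx i hne hprime hi _ _,
    M.nodeAbuts_dpscIdx i hne hprime hi _ _, M.vert_zero_ne_one hne hprime, ?_, rfl⟩
  rw [Iv_zero_dpscIdx, Iv_one_dpscIdx, IvNode_dpscIdx_eq, dpscIdx_sigmaIndex]
  exact (M.exists_branchPair_dpscIdx i hi).2.2.2

end Dpsc

/-- **Census form: for every nonempty set of primes `Σ` and every `Σ`-integer `i`, a DPSC datum WITH TWO DISTINCT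
ADJACENT VERTICES and node `Σ`-index `i` at which the typed `Prop_1_3_ii'` holds and its index clause is attained with
the value `i`** (together with (i), (iii), (iii′)). [cite: MochizukiAbsTopII2013, Prop 1.3 (ii) p.11] -/
theorem exists_twoVertex_nodal_model_ii'_index (Sigma : Set ℕ) (hne : Sigma.Nonempty) (hprime : ∀ p ∈ Sigma, p.Prime)
    (i : ℕ) (hi : IsSigmaInteger Sigma i) :
    ∃ X : DPSCIndexData.{0}, X.Sigma = Sigma ∧ (∃ v v' : X.Vert, v ≠ v' ∧ X.Adjacent v v') ∧
      (∃ e : X.Node, X.sigmaIndex e = i) ∧ (∀ e : X.Node, X.sigmaIndex e = i) ∧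
      X.Prop_1_3_ii' ∧ X.Prop_1_3_i ∧ X.toDPSCData.Prop13iii ∧ X.Prop_1_3_iii' ∧
      ∃ (e : X.Node) (v v' : X.Vert), X.nodeAbuts e v ∧ X.nodeAbuts e v' ∧ v ≠ v' ∧
        (X.Iv v ⊔ X.Iv v').relIndex (X.IvNode e) = i := by
  obtain ⟨M⟩ := Model.nonempty Sigma
  obtain ⟨e, v, v', hv, hv', hvv', hidx, -⟩ := M.branchPair_nonidle_dpscIdx i hne hprime hi
  exact ⟨M.dpscIdx hne hprime i hi, rfl,
    ⟨⟨(0 : Fin 2)⟩, ⟨(1 : Fin 2)⟩, M.vert_zero_ne_one hne hprime, M.adjacent_dpsc hne hprime _ _⟩,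
    ⟨⟨()⟩, rfl⟩, fun _ => rfl, M.prop_1_3_ii'_dpscIdx i hne hprime hi, M.prop_1_3_i_dpscIdx i hne hprime hi,
    M.prop13iii_dpscIdx i hne hprime hi, M.prop_1_3_iii'_dpscIdx i hne hprime hi, e, v, v', hv, hv', hvv', hidx⟩

end Literature.AnabelianGeometry.AbsoluteAnabelian.AbsTopII.TwoTripodNodal.Model

end
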